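import Literature.NumberTheory.EllipticCurves.TateCurve.NumberFieldUniformizationTwistedKernelOfReductionIff
import Literature.NumberTheory.GaloisRepresentations.DiscreteValuationDivisibleUnits
import HarnessLib

/-!
# `E(K̄_v)` modulo the kernel of reduction at a MULTIPLICATIVE place `v ∣ p`: `E₁(K̄_v)` is `p`-divisible, and the
# `Γ`-invariants of `E(K̄_v)/E₁(K̄_v)` are `p`-divisible for every subgroup `Γ ≤ Γ_{K_v}` (`p` odd) — the two local inputs
# (div₁), (div_H) of Howard's `f(𝔖_p(K_∞)) ⊆ H¹_{F_𝔮}(K, T_𝔮)` at `v ∣ p` (theorems only; no definition, no named fact)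

Topic `NumberTheory/EllipticCurves` (LEAD `bsd-wall-utd-p1` g26, crux r205 stmt-BirchSwinnertonDyer-24737 `TwinAlgMuZeroAtThree`,
line `beta-road` v10, K2 stub `stub_howardOutputsOfFamily`, D1-twin controls: the `v ∣ p` clause (ORD-ASCENT) of the compact control
map for a curve MULTIPLICATIVE above `p`).

x9's `LambdaAdicSelmerData.proj_conj_cocycle_sub_coboundary_mem_torsionFilAt` (`LambdaAdicSelmerDataOrdinaryProofs`) turns two local
facts at `v` into the `v ∣ p` clause of `f(𝔖) ⊆ H¹_{F_𝔮}`: (div₁) `E₁(K̄_v)` is `p^k`-divisible inside `E₁`, and (div_H)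
`p^a (E(K̄_v)/E₁)^{H} ⊆ p^k (E(K̄_v)/E₁)^{H}` for the local groups `H` of the layers.  At a place of GOOD ORDINARY reduction x9 gets
(div_H) from the finiteness of `Ẽ(𝔽_{q^{N₀}})` (`a = #T`); at a MULTIPLICATIVE place the component group over `K̄_v` is infinite and
that route is closed.  Here both facts are proved at a multiplicative `v ∣ p` through the tree's PROVED Tate uniformisation with the
reduction clause `E₁(K̄_v) = Ψ(1 + 𝔪)` (`TateCurve.exists_twistedTateUniformisation_localKernelOfReduction_iff`): `E(K̄_v)/E₁ ≅
K̄_vˣ/(1 + 𝔪)q^ℤ` up to the sign `χ`, and in residue characteristic `p` a unit whose `p^k`-th power is a principal unit is itself a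
principal unit (Frobenius is injective on `k̄`; tree `valuation_sub_one_lt_one_of_pow_prime_pow`) — so `p^k`-th ROOTS preserve both
`E₁` and `Γ`-invariance modulo `E₁`; in the non-split case the root is taken of `u q^i` with `j + 2i ≡ 0 (mod p^k)`, `2` being
invertible modulo `p^k` (`p` odd), where `|τu · u| = |q|^j` for the elements `τ` of `Γ` that flip `√γ`.  Hence (div_H) holds with
`a = 0` at multiplicative places.

* (private valuation helpers) · `mem_localKernelOfReduction_iff_exists_zpow_of_tate` — membership criterion `Ψ(w) ∈ E₁ ↔ w ∈ (1 + 𝔪)q^ℤ` for Tate data;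
* **`exists_nsmul_pow_eq_of_mem_localKernelOfReduction_of_hasMultiplicativeReductionAt`** — (div₁), every `p`, `v ∣ p` multiplicative;
* **`exists_fixedModKernel_nsmul_pow_eq_of_hasMultiplicativeReductionAt`** — (div_H) with `a = 0`, `p` odd, every `Γ ≤ Γ_{K_v}`.

BSD is not proved by any of this.

## References
* [SilvermanATAEC1994] J. H. Silverman, *Advanced Topics in the Arithmetic of Elliptic Curves*, §V.4 (PDF pp. 399–401), Thm. V.5.3.
* [GreenbergLNM1716] R. Greenberg, *Iwasawa theory for elliptic curves*, LNM 1716, §2 pp. 70–76.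
* [Howard2004HeegnerKolyvagin] B. Howard, Compositio Math. 140 (2004), Lemma 2.2.7 / Prop. 2.2.8.
* [SerreLocalFields1979] J.-P. Serre, *Local Fields*, Ch. IV §4 Prop. 17.
-/

noncomputable section

open scoped Classical NNReal
open NumberField IsDedekindDomain Field

namespace WeierstrassCurve

open Literature.NumberTheory.EllipticCurves Literature.NumberTheory.GaloisRepresentations
  IsDedekindDomain.HeightOneSpectrum Literature.NumberTheory.EllipticCurves.TateCurve

variable {K : Type} [Field K] [NumberField K] (W : WeierstrassCurve K) [W.IsElliptic]
  {p : ℕ} [hp : Fact p.Prime] {v : HeightOneSpectrum (𝓞 K)}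

/-! ## §1 Valuation bookkeeping in `K̄_v` at residue characteristic `p` -/

omit [W.IsElliptic] hp in
/-- `|p|_v < 1` in `K̄_v` at a place `v ∣ p`. [folklore] -/
private theorem spectralValuation_natCast_lt_one (hpv : ((p : ℕ) : 𝓞 K) ∈ v.asIdeal) :
    v.spectralValuation ((p : ℕ) : AlgebraicClosure (v.adicCompletion K)) < 1 := by
  have hw := coe_spectralValuation v
  have hpmem : ((p : ℕ) : v.adicCompletionIntegers K) ∈
      IsLocalRing.maximalIdeal (v.adicCompletionIntegers K) := by
    have h := (algebraMap_mem_maximalIdeal_adicCompletionIntegers_iff (v := v) ((p : ℕ) : 𝓞 K)).mpr hpv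
    simpa only [map_natCast] using h
  have hcoe : (((p : ℕ) : v.adicCompletionIntegers K) : v.adicCompletion K) = (p : v.adicCompletion K) := by
    norm_cast
  have e : ((p : ℕ) : AlgebraicClosure (v.adicCompletion K)) = algebraMap (v.adicCompletion K) _
      (((p : ℕ) : v.adicCompletionIntegers K) : v.adicCompletion K) := by
    rw [hcoe, map_natCast]
  rw [e, ← NNReal.coe_lt_coe, coe_spectralValuation_algebraMap hw, NNReal.coe_one,
    Valued.toNormedField.norm_lt_one_iff]
  exact mem_maximalIdeal_adicCompletionIntegers_iff.mp hpmem

omit [W.IsElliptic] in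
/-- **Frobenius injectivity on `k̄`, unit form**: at `v ∣ p`, a unit `x` of `K̄_v` whose `p^k`-th power is a principal unit is a
principal unit. [cite: SerreLocalFields1979, Ch. IV §4 Prop. 17] -/
theorem spectralValuation_sub_one_lt_one_of_pow (hpv : ((p : ℕ) : 𝓞 K) ∈ v.asIdeal) (k : ℕ)
    {x : AlgebraicClosure (v.adicCompletion K)} (hx : v.spectralValuation x = 1)
    (hxk : v.spectralValuation (x ^ p ^ k - 1) < 1) : v.spectralValuation (x - 1) < 1 :=
  valuation_sub_one_lt_one_of_pow_prime_pow v.spectralValuation (spectralValuation_natCast_lt_one (K := K) hpv) hx.le k hxk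

omit [W.IsElliptic] in
/-- A principal unit is a unit. [folklore] -/
private theorem spectralValuation_eq_one_of_sub_one_lt_one {x : AlgebraicClosure (v.adicCompletion K)}
    (hx : v.spectralValuation (x - 1) < 1) : v.spectralValuation x = 1 := by
  have h := Valuation.map_add_eq_of_lt_left v.spectralValuation (x := (1 : AlgebraicClosure (v.adicCompletion K)))
    (y := x - 1) (by rw [map_one]; exact hx)
  rwa [map_one, add_sub_cancel] at h

/-! ## §2 The membership criterion `Ψ(w) ∈ E₁ ↔ w ∈ (1 + 𝔪) q^ℤ` -/

omit [W.IsElliptic] in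
/-- **`Ψ(w) ∈ E₁(K̄_v) ↔ w ∈ (1 + 𝔪)·q^ℤ`** for Tate data `(q, Ψ)` with kernel `q^ℤ` and the reduction clause
`E₁ = Ψ(1 + 𝔪)`. [cite: SilvermanATAEC1994, §V.4 (PDF pp. 399–401)] -/
theorem mem_localKernelOfReduction_iff_exists_zpow_of_tate {q : v.adicCompletion K} (hq0 : q ≠ 0)
    (Ψ : Additive (AlgebraicClosure (v.adicCompletion K))ˣ →+ localPoints W (v.adicCompletion K))
    (hker : ∀ u : (AlgebraicClosure (v.adicCompletion K))ˣ, Ψ (Additive.ofMul u) = 0 ↔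
      ∃ n : ℤ, (u : AlgebraicClosure (v.adicCompletion K)) =
        algebraMap (v.adicCompletion K) (AlgebraicClosure (v.adicCompletion K)) q ^ n)
    (hiff : ∀ P : localPoints W (v.adicCompletion K), P ∈ W.localKernelOfReduction v ↔
      ∃ u : (AlgebraicClosure (v.adicCompletion K))ˣ,
        v.spectralValuation ((u : AlgebraicClosure (v.adicCompletion K)) - 1) < 1 ∧ Ψ (Additive.ofMul u) = P)
    (w : (AlgebraicClosure (v.adicCompletion K))ˣ) :
    Ψ (Additive.ofMul w) ∈ W.localKernelOfReduction v ↔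
      ∃ n : ℤ, v.spectralValuation
        ((w : AlgebraicClosure (v.adicCompletion K)) *
          (algebraMap (v.adicCompletion K) (AlgebraicClosure (v.adicCompletion K)) q ^ n)⁻¹ - 1) < 1 := by
  set L := AlgebraicClosure (v.adicCompletion K) with hL
  have hq' : algebraMap (v.adicCompletion K) L q ≠ 0 :=
    (map_ne_zero_iff _ (algebraMap (v.adicCompletion K) L).injective).2 hq0
  set qU : Lˣ := Units.mk0 _ hq' with hqU
  have hqn : ∀ n : ℤ, Ψ (Additive.ofMul (qU ^ n)) = 0 := fun n ↦
    (hker _).2 ⟨n, by rw [hqU, Units.val_zpow_eq_zpow_val, Units.val_mk0]⟩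
  constructor
  · intro h
    obtain ⟨u', hu'1, hu'⟩ := (hiff _).mp h
    have h0 : Ψ (Additive.ofMul (w * u'⁻¹)) = 0 := by
      rw [ofMul_mul, ofMul_inv, map_add, map_neg, hu', add_neg_cancel]
    obtain ⟨n, hn⟩ := (hker _).1 h0
    refine ⟨n, ?_⟩
    have e : (w : L) * (algebraMap (v.adicCompletion K) L q ^ n)⁻¹ = u' := by
      rw [← hn, Units.val_mul, Units.val_inv_eq_inv_val, mul_inv_rev, inv_inv, ← mul_assoc,
        mul_comm (w : L) (u' : L), mul_assoc, mul_inv_cancel₀ (Units.ne_zero w), mul_one]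
    rw [e]; exact hu'1
  · rintro ⟨n, hn⟩
    have e : (((w * (qU ^ n)⁻¹ : Lˣ)) : L) = (w : L) * (algebraMap (v.adicCompletion K) L q ^ n)⁻¹ := by
      rw [Units.val_mul, Units.val_inv_eq_inv_val, hqU, Units.val_zpow_eq_zpow_val, Units.val_mk0]
    have hmem : Ψ (Additive.ofMul (w * (qU ^ n)⁻¹)) ∈ W.localKernelOfReduction v :=
      (hiff _).mpr ⟨w * (qU ^ n)⁻¹, by rw [e]; exact hn, rfl⟩
    have hsplit : Ψ (Additive.ofMul w) = Ψ (Additive.ofMul (w * (qU ^ n)⁻¹)) + Ψ (Additive.ofMul (qU ^ n)) := by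
      rw [← map_add, ← ofMul_mul, inv_mul_cancel_right]
    rw [hsplit, hqn, add_zero]
    exact hmem

/-! ## §3 (div₁): `E₁(K̄_v)` is `p`-divisible at a multiplicative `v ∣ p` -/

/-- **(div₁) at a MULTIPLICATIVE `v ∣ p` (every `p`)**: every point of the kernel of reduction `E₁(K̄_v)` is `p^k • Z` for some
`Z ∈ E₁(K̄_v)` — `E₁ = Ψ(1 + 𝔪)` and a `p^k`-th root of a principal unit is a principal unit in residue characteristic `p`.  (At `p = 3`
this is x9/g25's `exists_nsmul_eq_of_mem_localKernelOfReduction_of_hasMultiplicativeReductionAt_three`, there by division polynomials.)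
[cite: SilvermanATAEC1994, §V.4 (PDF pp. 399–401)] [cite: GreenbergLNM1716, §2 p. 82 («since 𝓕(𝔪̄) is divisible»)] -/
theorem exists_nsmul_pow_eq_of_mem_localKernelOfReduction_of_hasMultiplicativeReductionAt
    (hpv : ((p : ℕ) : 𝓞 K) ∈ v.asIdeal) (hmult : W.HasMultiplicativeReductionAt v) (k : ℕ)
    {Q : localPoints W (v.adicCompletion K)} (hQ : Q ∈ W.localKernelOfReduction v) :
    ∃ Z ∈ W.localKernelOfReduction v, p ^ k • Z = Q := by
  set L := AlgebraicClosure (v.adicCompletion K) with hL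
  obtain ⟨q, t, Ψ, hq0, hq1, -, -, -, hker, -, hiff⟩ :=
    exists_twistedTateUniformisation_localKernelOfReduction_iff W v hmult
  obtain ⟨u, hu1, rfl⟩ := (hiff _).mp hQ
  obtain ⟨x, hx⟩ := IsAlgClosed.exists_pow_nat_eq (u : L) (pow_pos hp.out.pos k)
  have hx0 : x ≠ 0 := by
    intro h; rw [h, zero_pow (pow_ne_zero _ hp.out.ne_zero)] at hx; exact u.ne_zero hx.symm
  have hux : (Units.mk0 x hx0) ^ p ^ k = u := Units.ext (by rw [Units.val_pow_eq_pow_val, Units.val_mk0, hx])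
  have hu : v.spectralValuation (u : L) = 1 := spectralValuation_eq_one_of_sub_one_lt_one hu1
  have hxw : v.spectralValuation x = 1 := by
    have h1 : v.spectralValuation x ^ p ^ k = 1 := by rw [← map_pow, hx, hu]
    exact (pow_eq_one_iff_of_nonneg zero_le (pow_ne_zero _ hp.out.ne_zero)).mp h1
  have hx1 : v.spectralValuation (x - 1) < 1 :=
    spectralValuation_sub_one_lt_one_of_pow hpv k hxw (by rw [hx]; exact hu1)
  refine ⟨Ψ (Additive.ofMul (Units.mk0 x hx0)), (hiff _).mpr ⟨Units.mk0 x hx0, hx1, rfl⟩, ?_⟩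
  rw [← map_nsmul, ← ofMul_pow, hux]

/-! ## §4 (div_H) with `a = 0`: the `Γ`-invariants of `E(K̄_v)/E₁(K̄_v)` are `p`-divisible, `p` odd -/

/-- **(div_H) at a MULTIPLICATIVE `v ∣ p`, `p` odd, with NO loss of exponent (`a = 0`)**: for every subgroup `Γ ≤ Γ_{K_v}` and
every `R ∈ E(K̄_v)` invariant under `Γ` modulo `E₁(K̄_v)` there is `S ∈ E(K̄_v)`, invariant under `Γ` modulo `E₁`, with
`p^k S ≡ R (mod E₁)`.  Proof through `E(K̄_v)/E₁ ≅ K̄_vˣ/(1 + 𝔪)q^ℤ` (Tate, up to the sign `χ`): if `Γ` fixes `√γ`, any `p^k`-th root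
`w` of `u` (`R = Ψ(u)`) works, `σw/w` being a unit with principal `p^k`-th power `σu/u`; if some `τ ∈ Γ` flips `√γ`, then
`|τu·u| = |q|^j`, and a `p^k`-th root of `u q^i` with `j + 2i ≡ 0 (mod p^k)` works.  This is the hypothesis `hdivH` (with `a = 0`) of
x9's `LambdaAdicSelmerData.proj_conj_cocycle_sub_coboundary_mem_torsionFilAt` at a multiplicative place, where the good-reduction route
(finiteness of `Ẽ(𝔽_{q^{N₀}})`) is unavailable. [cite: SilvermanATAEC1994, §V.4, Thm. V.5.3] [cite: GreenbergLNM1716, §2 pp. 70–76] -/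
theorem exists_fixedModKernel_nsmul_pow_eq_of_hasMultiplicativeReductionAt (hp2 : p ≠ 2)
    (hpv : ((p : ℕ) : 𝓞 K) ∈ v.asIdeal) (hmult : W.HasMultiplicativeReductionAt v)
    (Γ : Subgroup (absoluteGaloisGroup (v.adicCompletion K))) (k : ℕ)
    (R : localPoints W (v.adicCompletion K)) (hR : ∀ σ ∈ Γ, σ • R - R ∈ W.localKernelOfReduction v) :
    ∃ S : localPoints W (v.adicCompletion K), (∀ σ ∈ Γ, σ • S - S ∈ W.localKernelOfReduction v) ∧
      p ^ k • S - R ∈ W.localKernelOfReduction v := by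
  set L := AlgebraicClosure (v.adicCompletion K) with hL
  obtain ⟨q, t, Ψ, hq0, hq1, -, -, hsurj, hker, hΨσ, hiff⟩ :=
    exists_twistedTateUniformisation_localKernelOfReduction_iff W v hmult
  have hw := coe_spectralValuation v
  have hq' : algebraMap (v.adicCompletion K) L q ≠ 0 :=
    (map_ne_zero_iff _ (algebraMap (v.adicCompletion K) L).injective).2 hq0
  have hwq0 : 0 < v.spectralValuation (algebraMap (v.adicCompletion K) L q) :=
    zero_lt_iff.2 ((map_ne_zero _).2 hq')
  have hwq : v.spectralValuation (algebraMap (v.adicCompletion K) L q) < 1 := by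
    rw [← NNReal.coe_lt_coe, coe_spectralValuation_algebraMap hw, NNReal.coe_one]
    exact Valued.toNormedField.norm_lt_one_iff.mpr hq1
  set qL := algebraMap (v.adicCompletion K) L q with hqL
  have hmemE := W.mem_localKernelOfReduction_iff_exists_zpow_of_tate hq0 Ψ hker hiff
  have hpk0 : 0 < p ^ k := pow_pos hp.out.pos k
  -- `R = Ψ(u)`
  obtain ⟨u0, rfl⟩ := hsurj R
  obtain ⟨u, rfl⟩ : ∃ u : Lˣ, Additive.ofMul u = u0 := ⟨Additive.toMul u0, ofMul_toMul u0⟩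
  -- Galois acts by isometries; the sign of `σ` on `√γ`
  have hiso : ∀ (σ : absoluteGaloisGroup (v.adicCompletion K)) (x : L),
      v.spectralValuation (Field.absoluteGaloisGroup.toAlgEquiv (v.adicCompletion K) σ x) = v.spectralValuation x :=
    fun σ x ↦ by rw [← Field.absoluteGaloisGroup.smul_def]; exact spectralValuation_smul hw σ x
  have hσq : ∀ σ : absoluteGaloisGroup (v.adicCompletion K),
      Field.absoluteGaloisGroup.toAlgEquiv (v.adicCompletion K) σ qL = qL := fun σ ↦ AlgEquiv.commutes _ q
  -- a unit lying in `(1 + 𝔪)q^ℤ` is a principal unit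
  have hunit : ∀ x : L, v.spectralValuation x = 1 →
      (∃ n : ℤ, v.spectralValuation (x * (qL ^ n)⁻¹ - 1) < 1) → v.spectralValuation (x - 1) < 1 := by
    rintro x hx ⟨n, hn⟩
    have h1 : v.spectralValuation (x * (qL ^ n)⁻¹) = 1 := spectralValuation_eq_one_of_sub_one_lt_one hn
    rw [map_mul, map_inv₀, map_zpow₀, hx, one_mul, inv_eq_one] at h1
    have hn0 : n = 0 := by
      rcases lt_trichotomy n 0 with hneg | h0 | hpos
      · exact absurd h1 (ne_of_gt (one_lt_zpow_of_neg₀ hwq0 hwq hneg))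
      · exact h0
      · exact absurd h1 (ne_of_lt (zpow_lt_one₀ hwq0 hwq hpos))
    rw [hn0, zpow_zero, inv_one, mul_one] at hn
    exact hn
  -- `p^k`-th roots of units with principal `p^k`-th power are principal units
  have hrootP : ∀ x y : L, v.spectralValuation y = 1 → x ^ p ^ k = y →
      v.spectralValuation (y - 1) < 1 → v.spectralValuation (x - 1) < 1 := by
    intro x y hy hxy hy1
    have hxw : v.spectralValuation x = 1 := by
      have h1 : v.spectralValuation x ^ p ^ k = 1 := by rw [← map_pow, hxy, hy]
      exact (pow_eq_one_iff_of_nonneg zero_le (pow_ne_zero _ hp.out.ne_zero)).mp h1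
    exact spectralValuation_sub_one_lt_one_of_pow hpv k hxw (by rw [hxy]; exact hy1)
  by_cases hfix : ∀ σ ∈ Γ, Field.absoluteGaloisGroup.toAlgEquiv (v.adicCompletion K) σ t = t
  · /- Case A: `Γ` fixes `√γ`, `Ψ` is `Γ`-equivariant: take any `p^k`-th root `w` of `u`. -/
    obtain ⟨x, hx⟩ := IsAlgClosed.exists_pow_nat_eq (u : L) hpk0
    have hx0 : x ≠ 0 := by
      intro h; rw [h, zero_pow (pow_ne_zero _ hp.out.ne_zero)] at hx; exact u.ne_zero hx.symm
    set wU : Lˣ := Units.mk0 x hx0 with hwU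
    have hwu : wU ^ p ^ k = u := Units.ext (by rw [Units.val_pow_eq_pow_val, hwU, Units.val_mk0, hx])
    refine ⟨Ψ (Additive.ofMul wU), fun σ hσ ↦ ?_, ?_⟩
    · have hΨ := hΨσ σ wU
      rw [if_pos (hfix σ hσ), one_zsmul] at hΨ
      have hΨu := hΨσ σ u
      rw [if_pos (hfix σ hσ), one_zsmul] at hΨu
      -- `σ • R - R = Ψ(σu/u) ∈ E₁`, so `σu/u` is a principal unit
      set ζ : Lˣ := Units.map (Field.absoluteGaloisGroup.toAlgEquiv (v.adicCompletion K) σ : L →* L) u * u⁻¹ with hζ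
      have hζmem : Ψ (Additive.ofMul ζ) ∈ W.localKernelOfReduction v := by
        have h := hR σ hσ
        rwa [hΨu, ← map_sub, ← ofMul_div, div_eq_mul_inv] at h
      have hζ1 : v.spectralValuation ((ζ : L)) = 1 := by
        rw [hζ, Units.val_mul, Units.val_inv_eq_inv_val, Units.coe_map, MonoidHom.coe_coe, map_mul, map_inv₀, hiso,
          mul_inv_cancel₀ ((map_ne_zero _).2 u.ne_zero)]
      have hζP : v.spectralValuation ((ζ : L) - 1) < 1 := hunit _ hζ1 ((hmemE ζ).mp hζmem)
      -- `σw/w` is a `p^k`-th root of `σu/u`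
      set ξ : Lˣ := Units.map (Field.absoluteGaloisGroup.toAlgEquiv (v.adicCompletion K) σ : L →* L) wU * wU⁻¹ with hξ
      have hξζ : (ξ : L) ^ p ^ k = ζ := by
        have e1 : ((Units.map (Field.absoluteGaloisGroup.toAlgEquiv (v.adicCompletion K) σ : L →* L) wU : Lˣ) : L) ^ p ^ k =
            Field.absoluteGaloisGroup.toAlgEquiv (v.adicCompletion K) σ (u : L) := by
          rw [Units.coe_map, MonoidHom.coe_coe, ← map_pow, ← Units.val_pow_eq_pow_val, hwu]
        have e2 : ((wU : Lˣ) : L) ^ p ^ k = (u : L) := by rw [← Units.val_pow_eq_pow_val, hwu]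
        have e3 : ((Units.map (Field.absoluteGaloisGroup.toAlgEquiv (v.adicCompletion K) σ : L →* L) u : Lˣ) : L) =
            Field.absoluteGaloisGroup.toAlgEquiv (v.adicCompletion K) σ (u : L) := by
          rw [Units.coe_map, MonoidHom.coe_coe]
        rw [hξ, hζ, Units.val_mul, Units.val_mul, Units.val_inv_eq_inv_val, Units.val_inv_eq_inv_val, mul_pow, inv_pow,
          e1, e2, e3]
      have hξP : v.spectralValuation ((ξ : L) - 1) < 1 := hrootP _ _ hζ1 hξζ hζP
      rw [hΨ, ← map_sub, ← ofMul_div, div_eq_mul_inv]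
      exact (hiff _).mpr ⟨ξ, hξP, rfl⟩
    · rw [← map_nsmul, ← ofMul_pow, hwu, sub_self]
      exact AddSubgroup.zero_mem _
  · /- Case B: some `τ ∈ Γ` flips `√γ`: `|τu · u| = |q|^j`; take a `p^k`-th root of `u q^i`, `j + 2i ≡ 0 (mod p^k)`. -/
    push Not at hfix
    obtain ⟨τ, hτΓ, hτ⟩ := hfix
    have hΨτu := hΨσ τ u
    rw [if_neg hτ, neg_one_zsmul] at hΨτu
    -- `τ • R - R = -Ψ(τu · u) ∈ E₁`
    set η : Lˣ := Units.map (Field.absoluteGaloisGroup.toAlgEquiv (v.adicCompletion K) τ : L →* L) u * u with hη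
    have hηmem : Ψ (Additive.ofMul η) ∈ W.localKernelOfReduction v := by
      have h := hR τ hτΓ
      rw [hΨτu, ← neg_add', ← map_add, ← ofMul_mul] at h
      exact (AddSubgroup.neg_mem_iff _).mp h
    obtain ⟨j, hj⟩ := (hmemE η).mp hηmem
    -- `i` with `j + 2 i = -j p^k` (`2 c = p^k + 1`)
    have hodd : Odd (p ^ k) := (hp.out.eq_two_or_odd'.resolve_left hp2).pow
    obtain ⟨c, hc⟩ := hodd.add_one
    set i : ℤ := -(j * c) with hi
    have hji : j + 2 * i = -(j * (p ^ k : ℕ)) := by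
      have hc' : ((p ^ k : ℕ) : ℤ) + 1 = (c : ℤ) + c := by exact_mod_cast hc
      rw [hi]; linear_combination j * hc'
    -- the root
    set qU : Lˣ := Units.mk0 qL hq' with hqU
    obtain ⟨x, hx⟩ := IsAlgClosed.exists_pow_nat_eq ((u * qU ^ i : Lˣ) : L) hpk0
    have hx0 : x ≠ 0 := by
      intro h; rw [h, zero_pow (pow_ne_zero _ hp.out.ne_zero)] at hx; exact (Units.ne_zero _) hx.symm
    set wU : Lˣ := Units.mk0 x hx0 with hwU
    have hwu : wU ^ p ^ k = u * qU ^ i := Units.ext (by rw [Units.val_pow_eq_pow_val, hwU, Units.val_mk0, hx])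
    have hqn : ∀ n : ℤ, Ψ (Additive.ofMul (qU ^ n)) = 0 := fun n ↦
      (hker _).2 ⟨n, by rw [hqU, Units.val_zpow_eq_zpow_val, Units.val_mk0]⟩
    refine ⟨Ψ (Additive.ofMul wU), fun σ hσ ↦ ?_, ?_⟩
    · by_cases hσt : Field.absoluteGaloisGroup.toAlgEquiv (v.adicCompletion K) σ t = t
      · -- `χ(σ) = 1`: as in Case A, `(σw/w)^{p^k} = σu/u` is a principal unit
        have hΨ := hΨσ σ wU
        rw [if_pos hσt, one_zsmul] at hΨ
        have hΨu := hΨσ σ u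
        rw [if_pos hσt, one_zsmul] at hΨu
        set ζ : Lˣ := Units.map (Field.absoluteGaloisGroup.toAlgEquiv (v.adicCompletion K) σ : L →* L) u * u⁻¹ with hζ
        have hζmem : Ψ (Additive.ofMul ζ) ∈ W.localKernelOfReduction v := by
          have h := hR σ hσ
          rwa [hΨu, ← map_sub, ← ofMul_div, div_eq_mul_inv] at h
        have hζ1 : v.spectralValuation ((ζ : L)) = 1 := by
          rw [hζ, Units.val_mul, Units.val_inv_eq_inv_val, Units.coe_map, MonoidHom.coe_coe, map_mul, map_inv₀, hiso,
            mul_inv_cancel₀ ((map_ne_zero _).2 u.ne_zero)]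
        have hζP : v.spectralValuation ((ζ : L) - 1) < 1 := hunit _ hζ1 ((hmemE ζ).mp hζmem)
        set ξ : Lˣ := Units.map (Field.absoluteGaloisGroup.toAlgEquiv (v.adicCompletion K) σ : L →* L) wU * wU⁻¹ with hξ
        have hξζ : (ξ : L) ^ p ^ k = ζ := by
          have e1 : ((Units.map (Field.absoluteGaloisGroup.toAlgEquiv (v.adicCompletion K) σ : L →* L) wU : Lˣ) : L) ^ p ^ k =
              Field.absoluteGaloisGroup.toAlgEquiv (v.adicCompletion K) σ ((u : L) * qL ^ i) := by
            rw [Units.coe_map, MonoidHom.coe_coe, ← map_pow, ← Units.val_pow_eq_pow_val, hwu, Units.val_mul, hqU,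
              Units.val_zpow_eq_zpow_val, Units.val_mk0]
          have e2 : ((wU : Lˣ) : L) ^ p ^ k = (u : L) * qL ^ i := by
            rw [← Units.val_pow_eq_pow_val, hwu, Units.val_mul, hqU, Units.val_zpow_eq_zpow_val, Units.val_mk0]
          rw [hξ, hζ, Units.val_mul, Units.val_mul, Units.val_inv_eq_inv_val, Units.val_inv_eq_inv_val, mul_pow, inv_pow,
            e1, e2, map_mul, map_zpow₀, hσq, Units.coe_map, MonoidHom.coe_coe, mul_inv_rev, mul_assoc,
            ← mul_assoc (qL ^ i), mul_inv_cancel₀ (zpow_ne_zero i hq'), one_mul]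
        have hξP : v.spectralValuation ((ξ : L) - 1) < 1 := hrootP _ _ hζ1 hξζ hζP
        rw [hΨ, ← map_sub, ← ofMul_div, div_eq_mul_inv]
        exact (hiff _).mpr ⟨ξ, hξP, rfl⟩
      · -- `χ(σ) = -1`: `σ • S - S = -Ψ(σw · w)` and `(σw · w)^{p^k} = σu · u · q^{2i} = (principal unit) · q^{-j p^k}`
        have hΨ := hΨσ σ wU
        rw [if_neg hσt, neg_one_zsmul] at hΨ
        have hΨu := hΨσ σ u
        rw [if_neg hσt, neg_one_zsmul] at hΨu
        set ησ : Lˣ := Units.map (Field.absoluteGaloisGroup.toAlgEquiv (v.adicCompletion K) σ : L →* L) u * u with hησ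
        have hησmem : Ψ (Additive.ofMul ησ) ∈ W.localKernelOfReduction v := by
          have h := hR σ hσ
          rw [hΨu, ← neg_add', ← map_add, ← ofMul_mul] at h
          exact (AddSubgroup.neg_mem_iff _).mp h
        obtain ⟨jσ, hjσ⟩ := (hmemE ησ).mp hησmem
        -- the exponents agree: `|ησ| = |u|² = |η| = |q|^j`
        have hval : ∀ (ρ : absoluteGaloisGroup (v.adicCompletion K)),
            v.spectralValuation (((Units.map (Field.absoluteGaloisGroup.toAlgEquiv (v.adicCompletion K) ρ : L →* L) u * u
              : Lˣ) : L)) = v.spectralValuation (u : L) * v.spectralValuation (u : L) := fun ρ ↦ by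
          rw [Units.val_mul, Units.coe_map, MonoidHom.coe_coe, map_mul, hiso]
        have hqpow : ∀ (y : L) (n : ℤ), v.spectralValuation (y * (qL ^ n)⁻¹ - 1) < 1 →
            v.spectralValuation y = v.spectralValuation qL ^ n := fun y n hy ↦ by
          have h1 := spectralValuation_eq_one_of_sub_one_lt_one hy
          rw [map_mul, map_inv₀, map_zpow₀] at h1
          rwa [mul_inv_eq_one₀ (zpow_ne_zero n ((map_ne_zero _).2 hq'))] at h1
        have hjj : jσ = j := by
          have h1 := hqpow _ _ hjσ
          have h2 := hqpow _ _ hj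
          rw [hval] at h1 h2
          rw [h2] at h1
          exact ((zpow_right_strictAnti₀ hwq0 hwq).injective h1).symm
        rw [hjj] at hjσ
        -- `y := σw · w · q^j` is a unit with principal `p^k`-th power
        set θ : Lˣ := Units.map (Field.absoluteGaloisGroup.toAlgEquiv (v.adicCompletion K) σ : L →* L) wU * wU with hθ
        have hθpow : (θ : L) ^ p ^ k = (ησ : L) * qL ^ (2 * i) := by
          have e1 : ((Units.map (Field.absoluteGaloisGroup.toAlgEquiv (v.adicCompletion K) σ : L →* L) wU : Lˣ) : L) ^ p ^ k =
              Field.absoluteGaloisGroup.toAlgEquiv (v.adicCompletion K) σ ((u : L) * qL ^ i) := by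
            rw [Units.coe_map, MonoidHom.coe_coe, ← map_pow, ← Units.val_pow_eq_pow_val, hwu, Units.val_mul, hqU,
              Units.val_zpow_eq_zpow_val, Units.val_mk0]
          have e2 : ((wU : Lˣ) : L) ^ p ^ k = (u : L) * qL ^ i := by
            rw [← Units.val_pow_eq_pow_val, hwu, Units.val_mul, hqU, Units.val_zpow_eq_zpow_val, Units.val_mk0]
          rw [hθ, Units.val_mul, mul_pow, e1, e2, map_mul, map_zpow₀, hσq, hησ, Units.val_mul, Units.coe_map,
            MonoidHom.coe_coe, two_mul, zpow_add₀ hq']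
          ring
        set y : L := (θ : L) * (qL ^ (-j))⁻¹ with hy
        have hypow : y ^ p ^ k = (ησ : L) * (qL ^ j)⁻¹ := by
          have h2i : 2 * i = -(j * (p ^ k : ℕ)) + -j := by linear_combination hji
          have hzz : (qL ^ (-j))⁻¹ ^ p ^ k = qL ^ (j * (p ^ k : ℕ)) := by
            rw [inv_pow, ← zpow_natCast (qL ^ (-j)), ← zpow_mul, ← zpow_neg]
            congr 1
            push_cast
            ring
          rw [hy, mul_pow, hθpow, hzz, h2i, zpow_add₀ hq', zpow_neg, zpow_neg]
          have hz0 : qL ^ (j * (p ^ k : ℕ)) ≠ 0 := zpow_ne_zero _ hq'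
          calc (ησ : L) * ((qL ^ (j * (p ^ k : ℕ)))⁻¹ * (qL ^ j)⁻¹) * qL ^ (j * (p ^ k : ℕ))
              = (ησ : L) * (qL ^ j)⁻¹ * ((qL ^ (j * (p ^ k : ℕ)))⁻¹ * qL ^ (j * (p ^ k : ℕ))) := by ring
            _ = (ησ : L) * (qL ^ j)⁻¹ := by rw [inv_mul_cancel₀ hz0, mul_one]
        have hη1 : v.spectralValuation ((ησ : L) * (qL ^ j)⁻¹) = 1 := spectralValuation_eq_one_of_sub_one_lt_one hjσ
        have hyP : v.spectralValuation (y - 1) < 1 := hrootP y _ hη1 hypow hjσ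
        -- hence `σw · w ∈ (1 + 𝔪) q^{-j}` and `Ψ(σw · w) ∈ E₁`
        have hθmem : Ψ (Additive.ofMul θ) ∈ W.localKernelOfReduction v :=
          (hmemE θ).mpr ⟨-j, by rw [← hy]; exact hyP⟩
        rw [hΨ, ← neg_add', ← map_add, ← ofMul_mul]
        exact (AddSubgroup.neg_mem_iff _).mpr hθmem
    · -- `p^k • S - R = Ψ(w^{p^k}) - Ψ(u) = Ψ(q^i) = 0`
      rw [← map_nsmul, ← ofMul_pow, hwu, ofMul_mul, map_add, hqn, add_zero, sub_self]
      exact AddSubgroup.zero_mem _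

end WeierstrassCurve

end
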